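import Summits.SmoothPoincare4.SmoothPoincare4.Theorems.CylinderEntropyCylinderRungTwoLimitHeightUnique
import Summits.SmoothPoincare4.SmoothPoincare4.Theorems.CylinderEntropyCylinderRungTwoHeightsConvergeOfUnique
import Summits.SmoothPoincare4.SmoothPoincare4.Theorems.CylinderEntropyCylinderRungTwoShiftLemma
import Summits.SmoothPoincare4.SmoothPoincare4.Theorems.CylinderEntropyCylinderRungTwoProductLimitOnSlice
import Mathlib.Order.Filter.AtTopBot.CountablyGenerated
import HarnessLib

/-!
# Route `CylinderEntropy`, crux `CylinderRungTwo` (stmt-SmoothPoincare4-7631), line `killing-flux`: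
# the area measures of a thin immortal cylinder flow converge to a multiple of one slice
# (registered helper `helper_measureConvergesToSlice`; lead c4, "relaxation up to multiplicity", A5b)

Along a smooth mean curvature flow `IsCylinderMCF M F ν T` of closed embedded cross-sections of
`N = S⁴ × ℝ ⊂ ℝ⁶` with thin slices (`λ_cyl(M_t) < 2` for `t ≥ T`) there is a height `c` such that
(i) the heights `(F s x)₅` converge to `c` uniformly in `x ∈ M` as `s → ∞`, and (ii) for every `C¹`
test function `φ : ℝ⁶ → ℝ` bounded together with its derivative on `N`, the area integrals
`∫ φ d((F s)^* μH⁴)` converge to `(A_∞ / vol(S⁴)) ∫_{S⁴} φ(y, c) dμH⁴(y)`, `A_∞ = inf_{t ≥ T} μH⁴(M_t)`: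
the measure-theoretic form ("relaxation up to multiplicity") of the convergence of the cross-sections
to the slice `S⁴ × {c}` with multiplicity `A_∞ / vol(S⁴) ∈ [1, 2)`.

Proof (everything below is landed machinery of the line).
* (i) is the composition of the landed `helper_heightsConvergeOfUnique` with `helper_limitHeightUnique`.
* The areas `μH⁴(M_s)` are antitone on `[T, ∞)` (dissipation budget), hence tend to `A_∞`
  (`tendsto_measure_range`).
* REDUCTION TO GOOD TIMES (`exists_goodTime_retraction`): by `helper_goodTimes` every unit window
  `[s - 1, s]` contains a good time `r(s)` whose slice energy is at most the window dissipation
  `W(s - 1) → 0`, and by the shift lemma (`helper_shiftLemma`)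
  `|∫ φ dμ_s - ∫ φ dμ_{r(s)}| ≤ A₀ W(s-1) + A₁ √(μH⁴(M_T) W(s-1)) → 0`.
* LIMIT ALONG GOOD SEQUENCES (`exists_subseq_tendsto_integral`): along any sequence of times
  `t n → ∞` with slice energies `→ 0`, after a tail shift making the areas `≤ A_∞ + 1`, sequential
  Prokhorov (`helper_limitMeasureExists`) gives a subsequence whose area measures converge weakly to a
  finite `μ` of mass `A_∞` carried by a slab of `N`; the product-test identities pass to the limit
  (`helper_productTestLimit`, `‖∂_r F‖² = H²`) and `μ` has the product property
  (`helper_equidistribution`); by (i) the bounded continuous cut-offs `min 1 (|z₅ - c| - η)⁺` have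
  eventually vanishing slice integrals, so `μ {z₅ ≠ c} = 0` (`measure_ne_height_eq_zero`), and
  `helper_productLimitOnSlice` identifies `μ = (A_∞ / vol(S⁴)) · (uniform measure of S⁴ × {c})`;
  finally `φ` agrees on `N` with the bounded continuous clamp `max (-A₀) (min A₀ φ)`
  (`exists_bcf_eqOn`), to which the weak convergence applies.
* ASSEMBLY: `atTop` on `ℝ` is countably generated, so by the subsequence principle
  (`Filter.tendsto_of_subseq_tendsto`) it suffices to extract from every sequence `s n → ∞` a
  subsequence along which `∫ φ dμ_{s n}` converges to the limit: take the good times `r(s n)` and the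
  subsequence of the previous step; the difference `∫ φ dμ_{s n} - ∫ φ dμ_{r(s n)}` tends to `0`.

Everything here is PROVED (no `sorry`, no definitions, no named facts).

References: K. A. Brakke, *The motion of a surface by its mean curvature* (1978), §3 (mass continuity
and limits of the area measures along the flow); P. Billingsley, *Convergence of probability measures*
(1999), Thms. 2.1 and 5.1.
-/

-- the prescribed namespace `Summit.SmoothPoincare4.SmoothPoincare4.…` repeats `SmoothPoincare4`
set_option linter.dupNamespace false

noncomputable section

open Bundle Set Function Filter MeasureTheory Module
open scoped Manifold ContDiff Topology RealInnerProductSpace BigOperators ENNReal NNReal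

namespace Summit.SmoothPoincare4.SmoothPoincare4.Cruxes.CylinderRungTwo.KillingFlux

open Literature.Geometry.Riemannian Literature.Geometry.Riemannian.EuclideanHypersurface
open Literature.Geometry.Lorentzian Literature.Geometry.Lorentzian.PseudoRiemannianMetric
open Literature.Geometry.Riemannian.SphericalCylinderEntropy (cylEntropy truncL)
open Literature.Geometry.Manifold.CylinderSlice (padL axis sum_sq_eq_one)
open Summit.SmoothPoincare4.SmoothPoincare4.Theorems.CylinderRungTwo.KillingFlux (vert_mem_Ncyl)
open LiminfDensityAlongGoodTimes

namespace MeasureConvergesToSlice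

/-! ## Two lemmas of pure measure theory on `ℝ⁶` -/

/-- **A weak limit of slices whose heights concentrate is carried by one height slice.**  If the
area measures `μH⁴ ⌊ range (ι k)` converge against bounded continuous functions to the finite measure
`μ` and for every `η > 0` eventually all heights `(ι k x)₅` lie within `η` of `c`, then
`μ {z₅ ≠ c} = 0`:
the bounded continuous cut-off `min 1 (|z₅ - c| - η)⁺ ≥ 0` has eventually vanishing slice integrals,
so its `μ`-integral vanishes and `μ {η < |z₅ - c|} = 0`; let `η = 1/(n+1) ↓ 0`. [folklore] -/
theorem measure_ne_height_eq_zero {M : Type*} (ι : ℕ → M → EuclideanSpace ℝ (Fin 6))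
    (μ : Measure (EuclideanSpace ℝ (Fin 6))) [IsFiniteMeasure μ]
    (hweak : ∀ g : BoundedContinuousFunction (EuclideanSpace ℝ (Fin 6)) ℝ,
      Tendsto (fun k => ∫ z in range (ι k), g z ∂(μH[4] : Measure (EuclideanSpace ℝ (Fin 6))))
        atTop (𝓝 (∫ z, g z ∂μ)))
    {c : ℝ} (hc : ∀ η : ℝ, 0 < η → ∀ᶠ k in atTop, ∀ x, |ι k x 5 - c| < η) :
    μ {z : EuclideanSpace ℝ (Fin 6) | z 5 ≠ c} = 0 := by
  have h5 : Continuous fun z : EuclideanSpace ℝ (Fin 6) => z 5 := PiLp.continuous_apply 2 _ 5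
  -- for each `η > 0`, `μ {η < |z₅ - c|} = 0`
  have hη : ∀ η : ℝ, 0 < η → μ {z : EuclideanSpace ℝ (Fin 6) | η < |z 5 - c|} = 0 := by
    intro η hη
    -- the cut-off `g z = min 1 (max 0 (|z₅ - c| - η))`
    let g : BoundedContinuousFunction (EuclideanSpace ℝ (Fin 6)) ℝ :=
      BoundedContinuousFunction.ofNormedAddCommGroup (fun z => min 1 (max 0 (|z 5 - c| - η)))
      (continuous_const.min (continuous_const.max ((h5.sub continuous_const).abs.sub
        continuous_const))) 1 (fun z => by
        rw [Real.norm_eq_abs, abs_le]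
        exact ⟨by linarith [le_min zero_le_one (le_max_left 0 (|z 5 - c| - η))], min_le_left _ _⟩)
    have hg : ∀ z, g z = min 1 (max 0 (|z 5 - c| - η)) := fun z => rfl
    have hg0 : ∀ z, 0 ≤ g z := fun z => le_min zero_le_one (le_max_left _ _)
    have hgpos : ∀ z : EuclideanSpace ℝ (Fin 6), η < |z 5 - c| → 0 < g z := fun z hz =>
      lt_min one_pos (lt_max_of_lt_right (sub_pos.2 hz))
    have hgzero : ∀ z : EuclideanSpace ℝ (Fin 6), |z 5 - c| < η → g z = 0 := fun z hz => by
      rw [hg, max_eq_left (sub_nonpos.2 hz.le), min_eq_right zero_le_one]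
    -- the slice integrals vanish eventually, hence so does `∫ g dμ`
    have hev : ∀ᶠ k in atTop,
        ∫ z in range (ι k), g z ∂(μH[4] : Measure (EuclideanSpace ℝ (Fin 6))) = 0 := by
      filter_upwards [hc η hη] with k hk
      refine setIntegral_eq_zero_of_forall_eq_zero fun z hz => ?_
      obtain ⟨x, rfl⟩ := hz
      exact hgzero _ (hk x)
    have hlim0 : ∫ z, g z ∂μ = 0 :=
      tendsto_nhds_unique (hweak g) (tendsto_const_nhds.congr' (EventuallyEq.symm hev))
    have hae : μ {z | g z ≠ 0} = 0 := by
      have h := (integral_eq_zero_iff_of_nonneg (fun z => hg0 z) (g.integrable μ)).1 hlim0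
      rw [Filter.EventuallyEq, ae_iff] at h
      simpa using h
    exact measure_mono_null (fun z hz => (hgpos z hz).ne') hae
  -- `{z₅ ≠ c} ⊆ ⋃ₙ {1/(n+1) < |z₅ - c|}`
  refine measure_mono_null (fun z hz => ?_)
    (measure_iUnion_null fun n : ℕ => hη (1 / ((n : ℝ) + 1)) Nat.one_div_pos_of_nat)
  obtain ⟨n, hn⟩ := exists_nat_one_div_lt (abs_pos.2 (sub_ne_zero.2 hz))
  exact mem_iUnion.2 ⟨n, hn⟩

/-- **Bounded continuous clamp.** A continuous `φ : ℝ⁶ → ℝ` with `|φ| ≤ A₀` on a set `P` agrees on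
`P` with the bounded continuous function `max (-A₀) (min A₀ φ)`. [folklore] -/
theorem exists_bcf_eqOn {φ : EuclideanSpace ℝ (Fin 6) → ℝ} (hφ : Continuous φ) {A₀ : ℝ}
    (hA₀ : 0 ≤ A₀) {P : EuclideanSpace ℝ (Fin 6) → Prop} (hb : ∀ z, P z → |φ z| ≤ A₀) :
    ∃ g : BoundedContinuousFunction (EuclideanSpace ℝ (Fin 6)) ℝ, ∀ z, P z → g z = φ z := by
  refine ⟨BoundedContinuousFunction.ofNormedAddCommGroup (fun z => max (-A₀) (min A₀ (φ z)))
    (continuous_const.max (continuous_const.min hφ)) A₀ (fun z => ?_), fun z hz => ?_⟩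
  · rw [Real.norm_eq_abs, abs_le]
    exact ⟨le_max_left _ _, max_le (neg_le_self hA₀) (min_le_left _ _)⟩
  · obtain ⟨h1, h2⟩ := abs_le.1 (hb z hz)
    show max (-A₀) (min A₀ (φ z)) = φ z
    rw [min_eq_right h2, max_eq_right h1]

/-! ## Flow pieces -/

section Flow

variable {M : Type} [TopologicalSpace M] [ChartedSpace (EuclideanSpace ℝ (Fin 4)) M]
  [IsManifold (𝓡 4) ∞ M] [T2Space M] [CompactSpace M] [MeasurableSpace M] [BorelSpace M]
  {F ν : ℝ → M → EuclideanSpace ℝ (Fin 6)} {T : ℝ}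

/-- **The areas of a cylinder flow tend to their infimum**: `μH⁴(M_s)` is antitone in `s ≥ T`
(dissipation budget for the flow restarted at the earlier time), so it converges to
`⨅_{t ≥ T} μH⁴(M_t)` as `s → ∞`. [folklore] -/
theorem tendsto_measure_range (hF : IsCylinderMCF M F ν T) :
    Tendsto (fun s => (μH[4] : Measure (EuclideanSpace ℝ (Fin 6))) (range (F s))) atTop
      (𝓝 (⨅ t : Ici T, (μH[4] : Measure (EuclideanSpace ℝ (Fin 6))) (range (F t)))) := by
  have hanti :
      Antitone fun t : Ici T => (μH[4] : Measure (EuclideanSpace ℝ (Fin 6))) (range (F t)) :=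
    fun s t hst =>
      le_add_self.trans ((hF.of_le (mem_Ici.1 s.2)).dissipationBudget (show (s : ℝ) ≤ t from hst))
  exact tendsto_comp_val_Ici_atTop.1 (tendsto_atTop_iInf hanti)

variable [SecondCountableTopology M]

/-- **Reduction to good times.** Along a cylinder flow there is a choice of good times `r(s) ≥ T`,
`r(s) ≥ s - 1` (so `r(s) → ∞`), with slice energies `E(r(s)) → 0` as `s → ∞`, such that for every
`C¹` test function `φ` with `|φ| ≤ A₀`, `‖Dφ‖ ≤ A₁` on `N` the area integrals at `s` and at `r(s)`
become equal in the limit: `∫ φ∘F_s d((F s)^*μH⁴) - ∫ φ∘F_{r(s)} d((F (r s))^*μH⁴) → 0`.  (Good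
times of `helper_goodTimes` in the window `[s - 1, s]`, and the shift lemma `helper_shiftLemma` on
`[r(s), s]`, whose error `A₀ W + A₁ √(μH⁴(M_T) W)` is controlled by the window dissipation
`W = W(s - 1) → 0`.) [cite: Brakke1978, §3] -/
theorem exists_goodTime_retraction (hF : IsCylinderMCF M F ν T) :
    ∃ r : ℝ → ℝ, (∀ s, T ≤ r s) ∧ Tendsto r atTop atTop ∧
      Tendsto (fun s => ∫⁻ x, ENNReal.ofReal (‖deriv (fun s' => F s' x) (r s)‖ ^ 2)
        ∂(Measure.comap (F (r s)) (μH[4] : Measure (EuclideanSpace ℝ (Fin 6))))) atTop (𝓝 0) ∧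
      ∀ (φ : EuclideanSpace ℝ (Fin 6) → ℝ), ContDiff ℝ 1 φ → ∀ A₀ A₁ : ℝ,
        (∀ z : EuclideanSpace ℝ (Fin 6), ∑ i : Fin 5, z (Fin.castSucc i) ^ 2 = 1 →
          |φ z| ≤ A₀ ∧ ‖fderiv ℝ φ z‖ ≤ A₁) →
        Tendsto (fun s =>
          ∫ x, φ (F s x) ∂(Measure.comap (F s) (μH[4] : Measure (EuclideanSpace ℝ (Fin 6)))) -
            ∫ x, φ (F (r s) x) ∂(Measure.comap (F (r s))
              (μH[4] : Measure (EuclideanSpace ℝ (Fin 6))))) atTop (𝓝 0) := by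
  obtain ⟨hW, hgood⟩ := helper_goodTimes M F ν T hF
  choose r hr hEr using fun s : ℝ => hgood (max T (s - 1)) (le_max_left _ _)
  have hTr : ∀ s, T ≤ r s := fun s => (le_max_left _ _).trans (hr s).1
  have hr1 : ∀ s, s - 1 ≤ r s := fun s => (le_max_right _ _).trans (hr s).1
  have hmax : Tendsto (fun s : ℝ => max T (s - 1)) atTop atTop :=
    tendsto_atTop_atTop.2 fun b => ⟨b + 1, fun s hs =>
      (show b ≤ s - 1 by linarith).trans (le_max_right _ _)⟩
  have hrt : Tendsto r atTop atTop :=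
    tendsto_atTop_atTop.2 fun b => ⟨b + 1, fun s hs => (show b ≤ s - 1 by linarith).trans (hr1 s)⟩
  have hWm := hW.comp hmax
  refine ⟨r, hTr, hrt, tendsto_of_tendsto_of_tendsto_of_le_of_le tendsto_const_nhds hWm
    (fun _ => zero_le) hEr, fun φ hφ A₀ A₁ hφb => ?_⟩
  -- nonnegativity of the bounds (the cylinder is nonempty)
  have he₀ : ∑ i : Fin 5, (EuclideanSpace.single (0 : Fin 6) (1 : ℝ) : EuclideanSpace ℝ (Fin 6))
      (Fin.castSucc i) ^ 2 = 1 := by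
    simp
  have hA₀ : 0 ≤ A₀ := (abs_nonneg _).trans (hφb _ he₀).1
  have hA₁ : 0 ≤ A₁ := (norm_nonneg _).trans (hφb _ he₀).2
  -- areas
  have haT : μH[4] (range (F T)) < ⊤ :=
    hausdorffMeasure_range_lt_top_six M (hF.isSmoothEmbedding T le_rfl)
  have harea : ∀ s, T ≤ s → μH[4] (range (F s)) ≤ μH[4] (range (F T)) := fun s hs =>
    le_add_self.trans (hF.dissipationBudget hs)
  -- the real error tends to `0`
  have hWr : Tendsto (fun s => (∫⁻ r' in Icc (max T (s - 1)) (max T (s - 1) + 1), ∫⁻ x,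
      ENNReal.ofReal (‖deriv (fun s' => F s' x) r'‖ ^ 2) ∂(Measure.comap (F r')
        (μH[4] : Measure (EuclideanSpace ℝ (Fin 6))))).toReal) atTop (𝓝 0) := by
    have h := (ENNReal.tendsto_toReal ENNReal.zero_ne_top).comp hWm
    rwa [ENNReal.toReal_zero] at h
  have herr :=
    (hWr.const_mul A₀).add (((hWr.const_mul (μH[4] (range (F T))).toReal).sqrt).const_mul A₁)
  simp only [mul_zero, Real.sqrt_zero, add_zero] at herr
  refine squeeze_zero_norm' ?_ herr
  filter_upwards [eventually_ge_atTop (T + 1)] with s hs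
  have hs1 : max T (s - 1) = s - 1 := max_eq_right (by linarith)
  have hrs : r s ≤ s := by have h := (hr s).2; rw [hs1, sub_add_cancel] at h; exact h
  -- the window dissipation over `[r s, s] ⊆ [s - 1, s]` is at most `W (s - 1) < ⊤`
  have hDle : (∫⁻ r' in Icc (r s) s, ∫⁻ x, ENNReal.ofReal (‖deriv (fun s' => F s' x) r'‖ ^ 2)
      ∂(Measure.comap (F r') (μH[4] : Measure (EuclideanSpace ℝ (Fin 6))))) ≤
      ∫⁻ r' in Icc (max T (s - 1)) (max T (s - 1) + 1), ∫⁻ x, ENNReal.ofReal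
        (‖deriv (fun s' => F s' x) r'‖ ^ 2) ∂(Measure.comap (F r')
          (μH[4] : Measure (EuclideanSpace ℝ (Fin 6)))) := by
    rw [hs1, sub_add_cancel]
    exact lintegral_mono_set (Icc_subset_Icc (hr1 s) le_rfl)
  have hWfin : (∫⁻ r' in Icc (max T (s - 1)) (max T (s - 1) + 1), ∫⁻ x, ENNReal.ofReal
      (‖deriv (fun s' => F s' x) r'‖ ^ 2) ∂(Measure.comap (F r')
        (μH[4] : Measure (EuclideanSpace ℝ (Fin 6))))) ≠ ⊤ := by
    rw [hs1, sub_add_cancel]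
    have h := (hF.of_le (show T ≤ s - 1 by linarith)).dissipationBudget (show s - 1 ≤ s by linarith)
    exact ne_top_of_le_ne_top haT.ne (le_self_add.trans (h.trans (harea _ (by linarith))))
  have hD := ENNReal.toReal_mono hWfin hDle
  -- the shift lemma on `[r s, s]`
  have hshift := helper_shiftLemma M F ν T hF φ hφ A₀ A₁ (r s) s (hTr s) hrs
    (fun r' hr' x => hφb _ (hF.mem_cyl r' ((hTr s).trans hr'.1) x))
  rw [Real.norm_eq_abs]
  refine hshift.trans (add_le_add (mul_le_mul_of_nonneg_left hD hA₀)
    (mul_le_mul_of_nonneg_left (Real.sqrt_le_sqrt ?_) hA₁))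
  have hx := mul_le_mul (mul_le_mul (show s - r s ≤ 1 by linarith [hr1 s])
    (ENNReal.toReal_mono haT.ne (harea _ (hTr s))) ENNReal.toReal_nonneg zero_le_one) hD
    ENNReal.toReal_nonneg (mul_nonneg zero_le_one ENNReal.toReal_nonneg)
  rwa [one_mul] at hx

/-- **The limit along good sequences.** Along a cylinder flow with uniformly converging heights
(`→ c`), for every sequence of times `t n → ∞` (`t n ≥ T`) with slice energies `→ 0` there is a
subsequence `θ` along which, for every continuous `φ` with `|φ| ≤ A₀` on `N`,
`∫ φ∘F_{t (θ n)} d((F (t (θ n)))^*μH⁴) → vol(S⁴)⁻¹ A_∞ ∫_{S⁴} φ(y, c) dμH⁴(y)`,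
`A_∞ = ⨅_{t ≥ T} μH⁴(M_t)`: tail shift making the areas `≤ A_∞ + 1`, sequential Prokhorov
(`helper_limitMeasureExists`), the product property of the limit (`helper_productTestLimit`,
`helper_equidistribution`), the slice carrier `μ {z₅ ≠ c} = 0` (`measure_ne_height_eq_zero`), the
identification `helper_productLimitOnSlice`, and the bounded continuous clamp of `φ`
(`exists_bcf_eqOn`), which agrees with `φ` on every slice and on `S⁴ × {c}`. [cite: Brakke1978, §3] -/
theorem exists_subseq_tendsto_integral (hF : IsCylinderMCF M F ν T) {t : ℕ → ℝ}
    (hTt : ∀ n, T ≤ t n) (ht : Tendsto t atTop atTop)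
    (hE : Tendsto (fun n => ∫⁻ x, ENNReal.ofReal (‖deriv (fun s => F s x) (t n)‖ ^ 2)
      ∂(Measure.comap (F (t n)) (μH[4] : Measure (EuclideanSpace ℝ (Fin 6))))) atTop (𝓝 0))
    {c : ℝ} (hc : ∀ ε : ℝ, 0 < ε → ∃ s₀ : ℝ, T ≤ s₀ ∧ ∀ s, s₀ ≤ s → ∀ x : M, |F s x 5 - c| < ε) :
    ∃ θ : ℕ → ℕ, StrictMono θ ∧ ∀ (φ : EuclideanSpace ℝ (Fin 6) → ℝ), Continuous φ → ∀ A₀ : ℝ,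
      (∀ z : EuclideanSpace ℝ (Fin 6), ∑ i : Fin 5, z (Fin.castSucc i) ^ 2 = 1 → |φ z| ≤ A₀) →
      Tendsto (fun n => ∫ x, φ (F (t (θ n)) x)
          ∂(Measure.comap (F (t (θ n))) (μH[4] : Measure (EuclideanSpace ℝ (Fin 6)))))
        atTop (𝓝 (((μH[4] (Metric.sphere (0 : EuclideanSpace ℝ (Fin 5)) 1)).toReal)⁻¹ *
          (⨅ t : Ici T, (μH[4] : Measure (EuclideanSpace ℝ (Fin 6))) (range (F t))).toReal *
          ∫ y in Metric.sphere (0 : EuclideanSpace ℝ (Fin 5)) 1, φ (padL y + c • axis)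
            ∂(μH[4] : Measure (EuclideanSpace ℝ (Fin 5))))) := by
  -- Step 0: the uniform height bound; the areas tend to `A < ⊤`
  obtain ⟨B, hB⟩ := exists_abs_apply_five_le hF
  set A : ℝ≥0∞ := ⨅ t : Ici T, (μH[4] : Measure (EuclideanSpace ℝ (Fin 6))) (range (F t)) with hA
  have haT : μH[4] (range (F T)) < ⊤ :=
    hausdorffMeasure_range_lt_top_six M (hF.isSmoothEmbedding T le_rfl)
  have hAtop : A < ⊤ :=
    (iInf_le (fun t : Ici T => (μH[4] : Measure (EuclideanSpace ℝ (Fin 6))) (range (F t)))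
      ⟨T, self_mem_Ici⟩).trans_lt haT
  have hAlim : Tendsto (fun n => (μH[4] : Measure (EuclideanSpace ℝ (Fin 6))) (range (F (t n))))
      atTop (𝓝 A) :=
    (tendsto_measure_range hF).comp ht
  -- Step 1: eventually the areas are `< A + 1`; shift the sequence by `k₀`
  obtain ⟨k₀, hk₀⟩ := eventually_atTop.1
    (hAlim.eventually (gt_mem_nhds (ENNReal.lt_add_right hAtop.ne one_ne_zero)))
  have hTk : ∀ k, T ≤ t (k + k₀) := fun k => hTt _
  -- Step 2: a weak limit `μ` of the area measures along a subsequence `θ` of the shifted slices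
  obtain ⟨θ, hθ, μ, hμ, hμA, hsupp, hweak⟩ := helper_limitMeasureExists M (fun k => F (t (k + k₀)))
    (fun k => hF.isSmoothEmbedding _ (hTk k)) (fun k w => hF.mem_cyl _ (hTk k) w) B
    (fun k w => hB _ (hTk k) w) A hAtop (fun k => (hk₀ (k + k₀) (Nat.le_add_left k₀ k)).le)
    (hAlim.comp (tendsto_add_atTop_nat k₀))
  haveI := hμ
  have hσ : StrictMono fun k => θ k + k₀ := fun i j hij => Nat.add_lt_add_right (hθ hij) k₀
  have hσT : Tendsto (fun k => θ k + k₀) atTop atTop := hσ.tendsto_atTop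
  have hTσ : ∀ k, T ≤ t (θ k + k₀) := fun k => hTt _
  -- Step 3: the product property of `μ`
  have hE' : Tendsto (fun k => ∫⁻ w, ENNReal.ofReal (‖deriv (fun s => F s w) (t (θ k + k₀))‖ ^ 2)
      ∂(Measure.comap (F (t (θ k + k₀))) (μH[4] : Measure (EuclideanSpace ℝ (Fin 6)))))
      atTop (𝓝 0) := hE.comp hσT
  have hH : Tendsto (fun k => ∫⁻ w, ENNReal.ofReal
      ((euclideanMetric (EuclideanSpace ℝ (Fin 6))).meanCurvature (F (t (θ k + k₀)))
        contMDiff_pullbackBilin_holds (hF.isSpacelikeImmersion _ (hTσ k)) (ν (t (θ k + k₀))) w ^ 2)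
      ∂(Measure.comap (F (t (θ k + k₀))) (μH[4] : Measure (EuclideanSpace ℝ (Fin 6)))))
      atTop (𝓝 0) :=
    hE'.congr fun k => lintegral_congr fun w => by rw [hF.norm_deriv_sq_eq (hTσ k) w]
  have hprodTest := helper_productTestLimit M (fun k => F (t (θ k + k₀)))
    (fun k => ν (t (θ k + k₀))) (fun k => hF.isSmoothEmbedding _ (hTσ k))
    (fun k w => hF.mem_cyl _ (hTσ k) w)
    (fun k => hF.isSpacelikeImmersion _ (hTσ k)) (fun k => hF.isUnitNormal _ (hTσ k))
    (fun k w => hF.normal_tangent _ (hTσ k) w) (fun k => hF.contMDiff_normal _ (hTσ k)) B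
    (fun k w => hB _ (hTσ k) w) hH A hAtop (hAlim.comp hσT) μ hsupp hweak
  have hprod := helper_equidistribution B μ hsupp hprodTest
  -- Step 4: `μ` is carried by the slice `{z₅ = c}` (the heights converge uniformly to `c`)
  have hslice : μ {z : EuclideanSpace ℝ (Fin 6) | z 5 ≠ c} = 0 := by
    refine measure_ne_height_eq_zero (fun k => F (t (θ k + k₀))) μ hweak fun η hη => ?_
    obtain ⟨s₀, -, hs₀⟩ := hc η hη
    filter_upwards [(ht.comp hσT).eventually (eventually_ge_atTop s₀)] with k hk
    exact hs₀ _ hk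
  -- Step 5: the identification of `μ` against bounded continuous functions
  have hident := helper_productLimitOnSlice μ B c hsupp hprod hslice
  refine ⟨fun k => θ k + k₀, hσ, fun φ hφ A₀ hφb => ?_⟩
  -- Step 6: the bounded continuous clamp of `φ` agrees with `φ` on the slices and on `S⁴ × {c}`
  have he₀ : ∑ i : Fin 5, (EuclideanSpace.single (0 : Fin 6) (1 : ℝ) : EuclideanSpace ℝ (Fin 6))
      (Fin.castSucc i) ^ 2 = 1 := by
    simp
  obtain ⟨g, hg⟩ := exists_bcf_eqOn hφ ((abs_nonneg _).trans (hφb _ he₀)) hφb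
  have hIg : ∀ k, ∫ x, φ (F (t (θ k + k₀)) x)
      ∂(Measure.comap (F (t (θ k + k₀))) (μH[4] : Measure (EuclideanSpace ℝ (Fin 6)))) =
      ∫ z in range (F (t (θ k + k₀))), g z ∂(μH[4] : Measure (EuclideanSpace ℝ (Fin 6))) :=
      fun k => by
    obtain ⟨hm, hN, -⟩ := range_measurable_mem_finite hF (hTσ k)
    rw [integral_comp_comap_eq hF (hTσ k)]
    exact setIntegral_congr_fun hm fun z hz => (hg z (hN z hz)).symm
  have hL : ∫ z, g z ∂μ =
      ((μH[4] (Metric.sphere (0 : EuclideanSpace ℝ (Fin 5)) 1)).toReal)⁻¹ * A.toReal *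
        ∫ y in Metric.sphere (0 : EuclideanSpace ℝ (Fin 5)) 1, φ (padL y + c • axis)
          ∂(μH[4] : Measure (EuclideanSpace ℝ (Fin 5))) := by
    rw [hident g, measureReal_def, hμA, setIntegral_congr_fun Metric.isClosed_sphere.measurableSet
      (fun y hy => hg (padL y + c • axis) (vert_mem_Ncyl (sum_sq_eq_one ⟨y, hy⟩) c))]
  have key : Tendsto (fun k => ∫ x, φ (F (t (θ k + k₀)) x)
      ∂(Measure.comap (F (t (θ k + k₀))) (μH[4] : Measure (EuclideanSpace ℝ (Fin 6)))))
      atTop (𝓝 (∫ z, g z ∂μ)) :=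
    (hweak g).congr fun k => (hIg k).symm
  rw [hL] at key
  exact key

end Flow

end MeasureConvergesToSlice

open MeasureConvergesToSlice

/-- **Registered helper `helper_measureConvergesToSlice` of line `killing-flux` (lead c4, relaxation
up to multiplicity, A5b): the area measures of a thin immortal cylinder flow converge to
`(A_∞ / vol(S⁴)) · [S⁴ × {c}]` against `C¹` test functions bounded on `N`.**  Along a smooth mean
curvature flow `IsCylinderMCF M F ν T` with `λ_cyl(M_t) < 2` (`t ≥ T`) there is `c ∈ ℝ` with (i) the
heights `(F s x)₅ → c` uniformly in `x` (`helper_heightsConvergeOfUnique` composed with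
`helper_limitHeightUnique`) and (ii) `∫ φ d((F s)^*μH⁴) → vol(S⁴)⁻¹ · A_∞ · ∫_{S⁴} φ(y, c) dμH⁴(y)`
for every `C¹` `φ` with `|φ| ≤ A₀`, `‖Dφ‖ ≤ A₁` on `N`, `A_∞ = ⨅_{t ≥ T} μH⁴(M_t)`: reduction to good
times by the shift lemma (`exists_goodTime_retraction`), the limit along good sequences
(`exists_subseq_tendsto_integral`: Prokhorov, product structure, slice carrier, identification), and
the subsequence principle for the countably generated filter `atTop` on `ℝ`. [cite: Brakke1978, §3] -/
theorem helper_measureConvergesToSlice : ∀ (M : Type) [TopologicalSpace M] [T2Space M] [SecondCountableTopology M] [ChartedSpace (EuclideanSpace ℝ (Fin 4)) M] [IsManifold (𝓡 4) ∞ M] [CompactSpace M] [MeasurableSpace M] [BorelSpace M] (F : ℝ → M → EuclideanSpace ℝ (Fin 6)) (ν : ℝ → M → EuclideanSpace ℝ (Fin 6)) (T : ℝ), IsCylinderMCF M F ν T → (∀ t, T ≤ t → Literature.Geometry.Riemannian.SphericalCylinderEntropy.cylEntropy (Set.range (F t)) < 2) → ∃ c : ℝ, (∀ ε : ℝ, 0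 < ε → ∃ s₀ : ℝ, T ≤ s₀ ∧ ∀ s, s₀ ≤ s → ∀ x : M, |F s x 5 - c| < ε) ∧ ∀ (φ : EuclideanSpace ℝ (Fin 6) → ℝ), ContDiff ℝ 1 φ → ∀ A₀ A₁ : ℝ, (∀ z : EuclideanSpace ℝ (Fin 6), ∑ i : Fin 5, z (Fin.castSucc i) ^ 2 = 1 → |φ z| ≤ A₀ ∧ ‖fderiv ℝ φ z‖ ≤ A₁) → Filter.Tendsto (fun s : ℝ => ∫ x, φ (F s x) ∂(Measure.comap (F s) (μH[4] : Measure (EuclideanSpace ℝ (Fin 6))))) Filter.atTop (𝓝 (((μH[4] (Metric.sphere (0 : EuclideanSpace ℝ (Fin 5)) 1)).toReal)⁻¹ * (⨅ t : Set.Ici T, μH[4] (Set.range (F t))).toReal * ∫ y in Metric.sphere (0 : EuclideanSpace ℝ (Fin 5)) 1, φ (Literature.Geometry.Manifold.CylinderSlice.padL y + c • Literature.Geometry.Manifold.CylinderSlice.axis) ∂(μH[4] : Measure (EuclideanSpace ℝ (Fin 5))))) := by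
  intro M _ _ _ _ _ _ _ _ F ν T hF hent
  -- (i) the heights converge uniformly to some `c`
  obtain ⟨c, hc⟩ := helper_heightsConvergeOfUnique helper_limitHeightUnique M F ν T hF hent
  refine ⟨c, hc, fun φ hφ A₀ A₁ hφb => ?_⟩
  -- (ii) reduction to good times
  obtain ⟨r, hTr, hrt, hEr, hdiff⟩ := exists_goodTime_retraction hF
  have hd := hdiff φ hφ A₀ A₁ hφb
  -- the subsequence principle: every sequence `s n → ∞` has a subsequence along which we converge
  refine tendsto_of_subseq_tendsto fun s hs => ?_
  obtain ⟨θ, hθm, hθ⟩ := exists_subseq_tendsto_integral hF (t := fun n => r (s n)) (fun n => hTr _)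
    (hrt.comp hs) (hEr.comp hs) hc
  refine ⟨θ, ?_⟩
  have h1 := hθ φ hφ.continuous A₀ fun z hz => (hφb z hz).1
  have h := (hd.comp (hs.comp hθm.tendsto_atTop)).add h1
  rw [zero_add] at h
  refine h.congr fun n => ?_
  simp only [Function.comp_apply, sub_add_cancel]

end Summit.SmoothPoincare4.SmoothPoincare4.Cruxes.CylinderRungTwo.KillingFlux

end
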